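import Mathlib
import HarnessLib

/-!
# `HeteroclinicTriggerChain` — crux `TriggerChainFrontStep` (item stmt-NavierStokesRegularity-22785):
  the RADIUS of the forced arc grows at most linearly — an a priori bound free of envelopes

The radius-drift lemma of `…ForcedArcWithin` bounds `|Q(t) − Q(0)|` (`Q = D² + 2u²`) by `6Mφt` with an
A PRIORI envelope `M ≥ |D|, |u|` — circular when one wants to PRODUCE the front-block envelope `M`. Here the
circularity is removed: since `Q′ = 2Df₁ + 4uf₂` and `|D| + 2|u| ≤ √3·√Q` (Cauchy–Schwarz), the radius
itself obeys `(√Q)′ ≤ √3·φ`, whence, with one-sided derivatives on the window,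

  `D(t)² + 2u(t)² ≤ (ρ₀ + √3·φ·t)²`  for any `ρ₀ ≥ 0` with `D(0)² + 2u(0)² ≤ ρ₀²`
  (`heteroclinicTriggerChain_forcedArcOn_radius_linear`),

so `|D(t)| ≤ ρ₀ + √3φt` and `|u(t)| ≤ (ρ₀ + √3φt)/√2`: the front-block envelope `M` of the lattice hop
lemmas (`…LatticeCapture/Delay/Seed`) follows from the initial radius and the forcing alone.

HONEST FRAMING: elementary real analysis of a planar ODE with bounded forcing on a segment; helper lemma
for the crux (no stub credit); nothing here is a statement about the Navier–Stokes equations; no summit,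
rung or crux is proved by this file.
-/

noncomputable section

set_option linter.dupNamespace false

open Real Set

namespace Summit.NavierStokesRegularity.NavierStokesRegularity.Theorems

/-- Cauchy–Schwarz for the arc radius: `(|D| + 2|u|)² ≤ 3(D² + 2u²)`. [folklore] -/
theorem htcRL_abs_add_two_abs_sq_le (D u : ℝ) : (|D| + 2 * |u|) ^ 2 ≤ 3 * (D ^ 2 + 2 * u ^ 2) := by
  nlinarith [sq_nonneg (|D| - |u|), sq_abs D, sq_abs u, abs_nonneg D, abs_nonneg u]

/-- **Linear growth of the radius, envelope-free.** On `[0,T]` (derivatives within the segment) let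
`D′ = −2eu² + f₁`, `u′ = eDu + f₂` with `|f₁|, |f₂| ≤ φ`, and `D(0)² + 2u(0)² ≤ ρ₀²` with `ρ₀ ≥ 0`. Then
`D(t)² + 2u(t)² ≤ (ρ₀ + √3·φ·t)²` for `t ∈ [0,T]`. [folklore] -/
theorem heteroclinicTriggerChain_forcedArcOn_radius_linear {e φ ρ₀ T : ℝ} {D u f₁ f₂ : ℝ → ℝ}
    (hρ₀ : 0 ≤ ρ₀)
    (hD : ∀ t ∈ Icc 0 T, HasDerivWithinAt D (-(2 * e * u t ^ 2) + f₁ t) (Icc 0 T) t)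
    (hu : ∀ t ∈ Icc 0 T, HasDerivWithinAt u (e * D t * u t + f₂ t) (Icc 0 T) t)
    (hf₁ : ∀ t ∈ Icc 0 T, |f₁ t| ≤ φ) (hf₂ : ∀ t ∈ Icc 0 T, |f₂ t| ≤ φ)
    (hQ0 : D 0 ^ 2 + 2 * u 0 ^ 2 ≤ ρ₀ ^ 2) :
    ∀ t ∈ Icc 0 T, D t ^ 2 + 2 * u t ^ 2 ≤ (ρ₀ + Real.sqrt 3 * φ * t) ^ 2 := by
  intro t ht
  rcases lt_or_ge T 0 with hT | hT
  · exact absurd (ht.1.trans ht.2) (not_le.2 hT)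
  have hφ : 0 ≤ φ := (abs_nonneg _).trans (hf₁ 0 ⟨le_rfl, hT⟩)
  have h3 : 0 ≤ Real.sqrt 3 := Real.sqrt_nonneg _
  have h3sq : Real.sqrt 3 ^ 2 = 3 := Real.sq_sqrt (by norm_num)
  -- the radius and its derivative
  have hQ : ∀ r ∈ Icc 0 T, HasDerivWithinAt (fun r => D r ^ 2 + 2 * u r ^ 2)
      (2 * D r * f₁ r + 4 * u r * f₂ r) (Icc 0 T) r := by
    intro r hr
    have h := ((hD r hr).pow 2).add (((hu r hr).pow 2).const_mul 2)
    refine h.congr_deriv ?_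
    push_cast; ring
  have hQc : ContinuousOn (fun r => D r ^ 2 + 2 * u r ^ 2) (Icc 0 T) := fun r hr =>
    (hQ r hr).continuousWithinAt
  have hQ' : ∀ r ∈ Ico 0 T, HasDerivWithinAt (fun r => D r ^ 2 + 2 * u r ^ 2)
      (2 * D r * f₁ r + 4 * u r * f₂ r) (Ici r) r := fun r hr =>
    (hQ r (Ico_subset_Icc_self hr)).mono_of_mem_nhdsWithin (Icc_mem_nhdsGE_of_mem hr)
  -- fence against B_ε = (ρ₀ + ε + (√3 φ + ε) t)²
  have hmain : ∀ ε : ℝ, 0 < ε →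
      D t ^ 2 + 2 * u t ^ 2 ≤ (ρ₀ + ε + (Real.sqrt 3 * φ + ε) * t) ^ 2 := by
    intro ε hε
    have hBd : ∀ r, HasDerivAt (fun r => (ρ₀ + ε + (Real.sqrt 3 * φ + ε) * r) ^ 2)
        (2 * (ρ₀ + ε + (Real.sqrt 3 * φ + ε) * r) * (Real.sqrt 3 * φ + ε)) r := by
      intro r
      have h := (((hasDerivAt_id r).const_mul (Real.sqrt 3 * φ + ε)).const_add (ρ₀ + ε)).pow 2
      refine h.congr_deriv ?_
      push_cast; simp only [id, mul_one]; ring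
    refine image_le_of_deriv_right_lt_deriv_boundary (f := fun r => D r ^ 2 + 2 * u r ^ 2)
      (a := 0) (b := T) hQc hQ' ?_ hBd ?_ ht
    · simp only [mul_zero, add_zero]
      calc D 0 ^ 2 + 2 * u 0 ^ 2 ≤ ρ₀ ^ 2 := hQ0
        _ ≤ (ρ₀ + ε) ^ 2 := by nlinarith
    · intro r hr hcontact
      have hr' := Ico_subset_Icc_self hr
      set B : ℝ := ρ₀ + ε + (Real.sqrt 3 * φ + ε) * r with hB
      have hBpos : 0 < B := by
        have : 0 ≤ (Real.sqrt 3 * φ + ε) * r := mul_nonneg (by nlinarith [mul_nonneg h3 hφ]) hr.1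
        linarith
      -- at contact Q = B², so |D| + 2|u| ≤ √3 B
      have hcs := htcRL_abs_add_two_abs_sq_le (D r) (u r)
      rw [hcontact] at hcs
      have hlin : |D r| + 2 * |u r| ≤ Real.sqrt 3 * B := by
        have hnn : 0 ≤ |D r| + 2 * |u r| := by positivity
        have hnn' : 0 ≤ Real.sqrt 3 * B := by positivity
        nlinarith [hcs, h3sq]
      have h1 : 2 * D r * f₁ r ≤ 2 * |D r| * φ := by
        have := abs_mul (D r) (f₁ r)
        have h' : D r * f₁ r ≤ |D r| * φ := by
          calc D r * f₁ r ≤ |D r * f₁ r| := le_abs_self _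
            _ = |D r| * |f₁ r| := abs_mul _ _
            _ ≤ |D r| * φ := mul_le_mul_of_nonneg_left (hf₁ r hr') (abs_nonneg _)
        linarith
      have h2 : 4 * u r * f₂ r ≤ 4 * |u r| * φ := by
        have h' : u r * f₂ r ≤ |u r| * φ := by
          calc u r * f₂ r ≤ |u r * f₂ r| := le_abs_self _
            _ = |u r| * |f₂ r| := abs_mul _ _
            _ ≤ |u r| * φ := mul_le_mul_of_nonneg_left (hf₂ r hr') (abs_nonneg _)
        linarith
      calc 2 * D r * f₁ r + 4 * u r * f₂ r ≤ 2 * φ * (|D r| + 2 * |u r|) := by linarith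
        _ ≤ 2 * φ * (Real.sqrt 3 * B) := mul_le_mul_of_nonneg_left hlin (by linarith)
        _ = 2 * B * (Real.sqrt 3 * φ) := by ring
        _ < 2 * B * (Real.sqrt 3 * φ + ε) := by nlinarith
  -- ε → 0 through square roots
  have hcoef : 0 ≤ ρ₀ + Real.sqrt 3 * φ * t := by
    have : 0 ≤ Real.sqrt 3 * φ * t := mul_nonneg (mul_nonneg h3 hφ) ht.1
    linarith
  have hroot : ∀ ε : ℝ, 0 < ε → Real.sqrt (D t ^ 2 + 2 * u t ^ 2) ≤ ρ₀ + Real.sqrt 3 * φ * t + ε * (1 + t) := by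
    intro ε hε
    have hB : 0 ≤ ρ₀ + ε + (Real.sqrt 3 * φ + ε) * t := by
      have : 0 ≤ (Real.sqrt 3 * φ + ε) * t := mul_nonneg (by nlinarith [mul_nonneg h3 hφ]) ht.1
      linarith
    have h := Real.sqrt_le_sqrt (hmain ε hε)
    rw [Real.sqrt_sq hB] at h
    calc Real.sqrt (D t ^ 2 + 2 * u t ^ 2) ≤ ρ₀ + ε + (Real.sqrt 3 * φ + ε) * t := h
      _ = ρ₀ + Real.sqrt 3 * φ * t + ε * (1 + t) := by ring
  have hsqrt : Real.sqrt (D t ^ 2 + 2 * u t ^ 2) ≤ ρ₀ + Real.sqrt 3 * φ * t := by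
    refine le_of_forall_pos_le_add fun δ hδ => ?_
    have h := hroot (δ / (1 + t)) (div_pos hδ (by linarith [ht.1]))
    rwa [div_mul_cancel₀ _ (by linarith [ht.1] : (1 + t) ≠ 0)] at h
  have hQnn : 0 ≤ D t ^ 2 + 2 * u t ^ 2 := by positivity
  calc D t ^ 2 + 2 * u t ^ 2 = Real.sqrt (D t ^ 2 + 2 * u t ^ 2) ^ 2 := (Real.sq_sqrt hQnn).symm
    _ ≤ (ρ₀ + Real.sqrt 3 * φ * t) ^ 2 := pow_le_pow_left₀ (Real.sqrt_nonneg _) hsqrt 2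

/-- **Front-block envelope from the radius.** In the same setting: `|D(t)| ≤ ρ₀ + √3φt` and
`2u(t)² ≤ (ρ₀ + √3φt)²` on `[0,T]`. [folklore] -/
theorem heteroclinicTriggerChain_forcedArcOn_envelope {e φ ρ₀ T : ℝ} {D u f₁ f₂ : ℝ → ℝ}
    (hρ₀ : 0 ≤ ρ₀)
    (hD : ∀ t ∈ Icc 0 T, HasDerivWithinAt D (-(2 * e * u t ^ 2) + f₁ t) (Icc 0 T) t)
    (hu : ∀ t ∈ Icc 0 T, HasDerivWithinAt u (e * D t * u t + f₂ t) (Icc 0 T) t)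
    (hf₁ : ∀ t ∈ Icc 0 T, |f₁ t| ≤ φ) (hf₂ : ∀ t ∈ Icc 0 T, |f₂ t| ≤ φ)
    (hQ0 : D 0 ^ 2 + 2 * u 0 ^ 2 ≤ ρ₀ ^ 2) :
    ∀ t ∈ Icc 0 T, |D t| ≤ ρ₀ + Real.sqrt 3 * φ * t ∧ 2 * u t ^ 2 ≤ (ρ₀ + Real.sqrt 3 * φ * t) ^ 2 := by
  intro t ht
  rcases lt_or_ge T 0 with hT | hT
  · exact absurd (ht.1.trans ht.2) (not_le.2 hT)
  have hφ : 0 ≤ φ := (abs_nonneg _).trans (hf₁ 0 ⟨le_rfl, hT⟩)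
  have h := heteroclinicTriggerChain_forcedArcOn_radius_linear hρ₀ hD hu hf₁ hf₂ hQ0 t ht
  have hcoef : 0 ≤ ρ₀ + Real.sqrt 3 * φ * t := by
    have : 0 ≤ Real.sqrt 3 * φ * t := mul_nonneg (mul_nonneg (Real.sqrt_nonneg _) hφ) ht.1
    linarith
  refine ⟨abs_le_of_sq_le_sq' ?_ hcoef |> fun h' => abs_le.2 h', by nlinarith [sq_nonneg (D t)]⟩
  nlinarith [sq_nonneg (u t)]

end Summit.NavierStokesRegularity.NavierStokesRegularity.Theorems

end
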